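import Literature.Barriers.ABC.NConjectureExponentSharp
import HarnessLib

/-!
# Hölzl–Kleine–Stephan's pairwise-coprime `5/3` family (proof of `PairwiseQualityFloorOdd`)

`Literature/Barriers/ABC/NConjectureExponentSharpOddProofs.lean` — discharges the named fact
`Literature.Barriers.ABC.PairwiseQualityFloorOdd` of `NConjectureExponentSharp.lean`:
for every odd `n ≥ 5` and every `θ < 5/3` there are infinitely many admissible
(zero sum, no common prime factor, no vanishing nonempty proper subsum) PAIRWISE COPRIME `n`-term
sums of quality `log max |aᵢ| / log rad(a₁ ⋯ aₙ) > θ`.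

## Source (verified on the page)

Hölzl–Kleine–Stephan, *Improved lower bounds for strong n-conjectures*, J. Aust. Math. Soc. 119
(2025) 61–81, arXiv:2409.13439, Theorem 12 and its proof [cite: HolzlKleineStephan2025, Theorem 12]:
"We will construct infinitely many `n`-tuples `(a₁, …, aₙ)` where `a₁ = (x−1)⁵`,
`a₂ = 10(x²+1)²`, `a₃ = −(x+1)⁵`. … there exist choices for `a₄, …, aₙ` that only depend on `n` …
Note that `(x−1)⁵ + 10(x²+1)² − (x+1)⁵ = 8` holds independently of the choice of `x`; thus
`8 + a₄ + a₅ + … + aₙ = 0` … all of `a₄, a₅, …, aₙ` are odd; moreover, they are pairwise coprime by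
construction. Set `y = σₙ!` and consider the equation `y² s² − (y²+1) t² = −1`. As there is an
initial solution `(s, t) = (1, 1)` … [it] has infinitely many integer solutions … let `x = y·s`.
Thus `x` is a multiple of each element of `F` and of each of `a₄, a₅, …, aₙ`; and therefore `x−1`,
`x+1` and `x²+1` are each coprime with any of these numbers. … the term
`a₂ = 10(x²+1)² = 10(y²+1)² t⁴` only contributes a factor `t ∈ O(x)` to the radical. Thus we have
`rad(a₁ ⋯ aₙ) ∈ O(x³)`. On the other hand, `max{|a₁|, …, |aₙ|} = |a₃| = |x+1|⁵ … and therefore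
`Q_{U(F,n)} ≥ … = 5/3`."

## Lean rendering of the proof

We follow the printed proof with two simplifications that the statement `PairwiseQualityFloorOdd`
(Ramaekers' class `R(n)`: `{0,1}`-subsums, no forbidden factors, i.e. `F = ∅`) allows:

* the constants `a₄, …, aₙ` (`n = 2j + 5`) are the explicit block
  `c = (−(2j+8+r), r, 1, …, 1)` (sum `−8`) with a parameter `r > 0` subject to
  `gcd(10, r) = gcd(10, 2j+8+r) = gcd(r, 2j+8) = 1`; at the end `r = 1`, or `r = 4j + 17` when
  `5 ∣ 2j + 9`. (The paper's growing primes and Lemma 15 serve the stronger `{−1,0,1}`-subsum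
  condition and the forbidden set `F`, neither of which is part of `PairwiseQualityFloorOdd`.)
* the Pell solutions are generated explicitly: `x₀ = y`, `t₀ = 1`,
  `x' = (2y²+1)x + 2y(y²+1)t`, `t' = (2y²+1)t + 2yx` preserves `x² + 1 = (y²+1)t²` and `y ∣ x`
  (`exists_pell_solution`), with `y = 10·r·(2j+8+r)`.

Admissibility: if a nonempty proper subsum vanishes, so does its complement, so we may assume the
index of `−(x+1)⁵` is absent; then the presence of `(x−1)⁵` or of `10(x²+1)²` forces a positive sum
(they dominate `2j+8+r`, the only other negative entry), and a nonempty family of constants alone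
never sums to zero (`hksConst_subsum_ne_zero`). Radical: the product divides a power of
`B = (x+1)(x−1)·10(y²+1)t·(2j+8+r)r`, so `rad ≤ B ≤ K·x³` (`t ≤ x`), while `max |aᵢ| ≥ x⁵`; the
elementary limit is `nQuality_gt_of_pow_bounds`, and infinitude follows from unbounded `max |aᵢ|`.

Scope note: the witnesses lie in Ramaekers' class `R(n)` (pairwise coprime, no vanishing nonempty
proper `{0,1}`-subsum), which is exactly what `PairwiseQualityFloorOdd` asks; for `n ≥ 7` they repeat
the entry `1` and so are not in the paper's smaller class `U(∅, n)` (`{−1,0,1}`-subsums), whose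
treatment needs the paper's Lemma 15 — not formalised here. What is NOT here: Theorem 13
(`PairwiseQualityFloor`, `5/4` for all `n ≥ 6`), discharged separately in the sibling file
`NConjectureExponentSharpProofs.lean` (`PairwiseQualityFloor_holds`); this file is independent of it.
-/

noncomputable section

open Finset UniqueFactorizationMonoid

namespace Literature.Barriers.ABC

/-! ### Generic lemmas -/

/-- Quality from power bounds: if `max |aᵢ| ≥ X^p` and `1 < rad(∏ aᵢ) ≤ K X^q` with `θ q < p`, then
the quality exceeds `θ` as soon as `X ≥ X₀(K, θ, p, q)`. [folklore] -/
theorem nQuality_gt_of_pow_bounds {n p q : ℕ} {K θ : ℝ} (hK : 1 ≤ K) (hθq : θ * q < p) :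
    ∃ X₀ : ℝ, ∀ (a : Fin n → ℤ) (X : ℝ), X₀ ≤ X → X ^ p ≤ (tupleMax a : ℝ) →
      (1 : ℝ) < ((radical (∏ i, a i) : ℤ) : ℝ) →
      ((radical (∏ i, a i) : ℤ) : ℝ) ≤ K * X ^ q → θ < nQuality a := by
  rcases lt_or_ge θ 0 with hθ0 | hθ0
  · refine ⟨1, fun a X hX hM hR1 _ => ?_⟩
    have hlogR : 0 < Real.log ((radical (∏ i, a i) : ℤ) : ℝ) := Real.log_pos hR1
    have hM1 : (1 : ℝ) ≤ tupleMax a := le_trans (one_le_pow₀ hX) hM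
    unfold nQuality
    rw [lt_div_iff₀ hlogR]
    calc θ * Real.log ((radical (∏ i, a i) : ℤ) : ℝ) < 0 := mul_neg_of_neg_of_pos hθ0 hlogR
      _ ≤ Real.log (tupleMax a) := Real.log_nonneg hM1
  · have hpq : 0 < (p : ℝ) - θ * q := by linarith
    set c : ℝ := θ * Real.log K / ((p : ℝ) - θ * q) with hc
    refine ⟨max 2 (Real.exp c + 1), fun a X hX hM hR1 hRle => ?_⟩
    have hX2 : 2 ≤ X := le_trans (le_max_left _ _) hX
    have hXc : Real.exp c < X := by
      have := le_max_right 2 (Real.exp c + 1)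
      linarith
    have hlogX : c < Real.log X := by
      rw [Real.lt_log_iff_exp_lt (by linarith)]
      exact hXc
    have hlogR : 0 < Real.log ((radical (∏ i, a i) : ℤ) : ℝ) := Real.log_pos hR1
    have hXp : 0 < X ^ p := by positivity
    have hlogM : (p : ℝ) * Real.log X ≤ Real.log (tupleMax a) := by
      rw [← Real.log_pow]
      exact Real.log_le_log hXp hM
    have hK0 : 0 < K := by linarith
    have hlogRle : Real.log ((radical (∏ i, a i) : ℤ) : ℝ) ≤ Real.log K + q * Real.log X := by
      rw [← Real.log_pow, ← Real.log_mul hK0.ne' (by positivity)]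
      exact Real.log_le_log (by linarith) hRle
    have hc' : θ * Real.log K < ((p : ℝ) - θ * q) * Real.log X := by
      have h := (div_lt_iff₀ hpq).mp hlogX
      linarith
    unfold nQuality
    rw [lt_div_iff₀ hlogR]
    calc θ * Real.log ((radical (∏ i, a i) : ℤ) : ℝ) ≤ θ * (Real.log K + q * Real.log X) :=
          mul_le_mul_of_nonneg_left hlogRle hθ0
      _ < p * Real.log X := by linarith
      _ ≤ Real.log (tupleMax a) := hlogM

/-- Pairwise coprimality of a `vecCons`-tuple from that of its head against the tail and of the
tail. [folklore] -/
theorem pairwise_isCoprime_cons {m : ℕ} {x : ℤ} {v : Fin m → ℤ} (hx : ∀ i, IsCoprime x (v i))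
    (hv : Pairwise fun i k => IsCoprime (v i) (v k)) :
    Pairwise fun i k => IsCoprime (Matrix.vecCons x v i) (Matrix.vecCons x v k) := by
  intro i k hik
  rcases Fin.eq_zero_or_eq_succ i with rfl | ⟨i, rfl⟩
  · rcases Fin.eq_zero_or_eq_succ k with rfl | ⟨k, rfl⟩
    · exact absurd rfl hik
    · simpa using hx k
  · rcases Fin.eq_zero_or_eq_succ k with rfl | ⟨k, rfl⟩
    · simpa using (hx i).symm
    · have hik' : i ≠ k := fun h => hik (by rw [h])
      simpa using hv hik'

/-- A divisor of `X` is coprime to `X + 1`, `X − 1` and `X² + 1` ("`x` is a multiple of each of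
`a₄, …, aₙ`; and therefore `x−1`, `x+1` and `x²+1` are each coprime with any of these numbers").
[cite: HolzlKleineStephan2025, proof of Theorem 12] -/
theorem isCoprime_of_dvd_param {X d : ℤ} (hd : d ∣ X) :
    IsCoprime (X + 1) d ∧ IsCoprime (X - 1) d ∧ IsCoprime (X ^ 2 + 1) d := by
  obtain ⟨e, rfl⟩ := hd
  exact ⟨⟨1, -e, by ring⟩, ⟨-1, e, by ring⟩, ⟨1, -(d * e * e), by ring⟩⟩

/-- For even `X`: `X + 1`, `X − 1`, `X² + 1` are pairwise coprime ("As `x` is even, `(x−1)⁵` and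
`(x+1)⁵` are coprime and `x²+1` is coprime with `x²−1`"). [cite: HolzlKleineStephan2025, proof of Theorem 12] -/
theorem isCoprime_of_even_param {X : ℤ} (h2 : 2 ∣ X) :
    IsCoprime (X + 1) (X - 1) ∧ IsCoprime (X + 1) (X ^ 2 + 1) ∧ IsCoprime (X - 1) (X ^ 2 + 1) := by
  obtain ⟨z, rfl⟩ := h2
  exact ⟨⟨1 - z, z, by ring⟩, ⟨z * (2 * z - 1) + 1, -z, by ring⟩, ⟨-(z * (2 * z + 1) + 1), z, by ring⟩⟩

/-- `gcd(10, m) = 1` for `m` prime to `2` and `5`. [folklore] -/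
theorem isCoprime_ten_of_not_dvd {m : ℕ} (h2 : ¬ 2 ∣ m) (h5 : ¬ 5 ∣ m) :
    IsCoprime (10 : ℤ) (m : ℤ) := by
  have h : Nat.Coprime (2 * 5) m :=
    Nat.Coprime.mul_left ((Nat.Prime.coprime_iff_not_dvd Nat.prime_two).2 h2)
      ((Nat.Prime.coprime_iff_not_dvd Nat.prime_five).2 h5)
  have h' : IsCoprime ((10 : ℕ) : ℤ) (m : ℤ) := by
    rw [Int.isCoprime_iff_gcd_eq_one, Int.gcd_natCast_natCast]
    simpa using h
  simpa using h'

/-! ### The Pell solutions -/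

/-- The Pell solutions used in the proof: for `y > 0` and every `k` there are `x ≥ y + k` and `t > 0`
with `x² + 1 = (y²+1) t²` and `y ∣ x` — the solutions `x = ys` of "`y² s² − (y²+1) t² = −1` … As
there is an initial solution `(s, t) = (1, 1)` … [it] has infinitely many integer solutions",
generated here explicitly from `(x, t) = (y, 1)` by the unit `2y² + 1 + 2y·√(y²(y²+1))`:
`x' = (2y²+1)x + 2y(y²+1)t`, `t' = (2y²+1)t + 2yx`. [cite: HolzlKleineStephan2025, proof of Theorem 12] -/
theorem exists_pell_solution {y : ℤ} (hy : 0 < y) (k : ℕ) :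
    ∃ x t : ℤ, x ^ 2 + 1 = (y ^ 2 + 1) * t ^ 2 ∧ y ∣ x ∧ y + k ≤ x ∧ 0 < t := by
  induction k with
  | zero => exact ⟨y, 1, by ring, dvd_rfl, by simp, one_pos⟩
  | succ k ih =>
    obtain ⟨x, t, h1, h2, h3, h4⟩ := ih
    have hx0 : 0 < x := by
      have : (0 : ℤ) ≤ k := by positivity
      linarith
    refine ⟨(2 * y ^ 2 + 1) * x + 2 * y * (y ^ 2 + 1) * t, (2 * y ^ 2 + 1) * t + 2 * y * x,
      by linear_combination h1, ?_, ?_, by positivity⟩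
    · exact dvd_add (dvd_mul_of_dvd_right h2 _) ⟨2 * (y ^ 2 + 1) * t, by ring⟩
    · push_cast
      have hyx : 0 < y ^ 2 * x := by positivity
      have hyt : 0 < y * (y ^ 2 + 1) * t := by positivity
      nlinarith

/-- From `x² + 1 = (y²+1)t²` with `y ≥ 1`, `x ≥ 0`: `t ≤ x` ("`t ∈ O(x)`").
[cite: HolzlKleineStephan2025, proof of Theorem 12] -/
theorem pell_t_le_x {x y t : ℤ} (hy : 1 ≤ y) (hx : 0 ≤ x)
    (h : x ^ 2 + 1 = (y ^ 2 + 1) * t ^ 2) : t ≤ x := by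
  by_contra hlt
  have h1 : x + 1 ≤ t := by rw [not_le] at hlt; exact hlt
  have h2 : (x + 1) ^ 2 ≤ t ^ 2 := pow_le_pow_left₀ (by linarith) h1 2
  have hy2 : 1 ≤ y ^ 2 := one_le_pow₀ hy
  have h3 : t ^ 2 ≤ y ^ 2 * t ^ 2 := by nlinarith [sq_nonneg t]
  nlinarith

/-! ### The constants block `a₄, …, aₙ`

The constants `(a₄, …, aₙ)` for `n = 2j + 5` terms are the block `c = (−(2j+8+r), r, 1, …, 1)`
(`2j` ones), of sum `−8 = −((x−1)⁵ + 10(x²+1)² − (x+1)⁵)`; `r` is a parameter (`hks_infinite`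
takes `gcd(10, r) = gcd(10, 2j+8+r) = gcd(r, 2j+8) = 1`). This replaces the paper's growing primes
and Lemma 15, which serve the stronger `{−1,0,1}`-subsum condition not required by
`PairwiseQualityFloorOdd`. This proof file introduces no definitions: the block is the explicit
`Matrix.vecCons` term, passed to each lemma as `(c, hc : c = …)`. -/

/-- "`8 + a₄ + a₅ + … + aₙ = 0`": the constants sum to `−8`. [cite: HolzlKleineStephan2025, proof of Theorem 12] -/
theorem hksConst_sum (j : ℕ) (r : ℤ) (c : Fin (2 * j + 2) → ℤ)
    (hc : c = Matrix.vecCons (-(2 * (j : ℤ) + 8 + r)) (Matrix.vecCons r fun _ : Fin (2 * j) => 1)) :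
    ∑ i, c i = -8 := by
  subst hc
  rw [Fin.sum_univ_succ, Fin.sum_univ_succ]
  simp only [Matrix.cons_val_zero, Matrix.cons_val_succ, Finset.sum_const,
    Finset.card_univ, Fintype.card_fin, nsmul_eq_mul, mul_one]
  push_cast
  ring

/-- Every constant divides `r (2j+8+r)` (hence `y = 10 r (2j+8+r)` and every `x` of the family).
[cite: HolzlKleineStephan2025, proof of Theorem 12] -/
theorem hksConst_dvd (j : ℕ) (r : ℤ) (c : Fin (2 * j + 2) → ℤ)
    (hc : c = Matrix.vecCons (-(2 * (j : ℤ) + 8 + r)) (Matrix.vecCons r fun _ : Fin (2 * j) => 1))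
    (i : Fin (2 * j + 2)) : c i ∣ r * (2 * (j : ℤ) + 8 + r) := by
  subst hc
  rcases Fin.eq_zero_or_eq_succ i with rfl | ⟨i, rfl⟩
  · simp only [Matrix.cons_val_zero, neg_dvd]
    exact dvd_mul_left _ _
  · rcases Fin.eq_zero_or_eq_succ i with rfl | ⟨k, rfl⟩
    · simp only [Matrix.cons_val_succ, Matrix.cons_val_zero]
      exact dvd_mul_right _ _
    · simp

/-- Every constant is prime to `10` ("each of `2`, `5`, and `10` is coprime with each of
`a₄, a₅, …, aₙ`"). [cite: HolzlKleineStephan2025, proof of Theorem 12] -/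
theorem hksConst_coprime_ten (j : ℕ) {r : ℤ} (h10r : IsCoprime 10 r)
    (h10N : IsCoprime 10 (2 * (j : ℤ) + 8 + r)) (c : Fin (2 * j + 2) → ℤ)
    (hc : c = Matrix.vecCons (-(2 * (j : ℤ) + 8 + r)) (Matrix.vecCons r fun _ : Fin (2 * j) => 1))
    (i : Fin (2 * j + 2)) : IsCoprime 10 (c i) := by
  subst hc
  rcases Fin.eq_zero_or_eq_succ i with rfl | ⟨i, rfl⟩
  · simpa using h10N.neg_right
  · rcases Fin.eq_zero_or_eq_succ i with rfl | ⟨k, rfl⟩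
    · simpa using h10r
    · simp only [Matrix.cons_val_succ]
      exact isCoprime_one_right

/-- The constants are pairwise coprime ("moreover, they are pairwise coprime by construction").
[cite: HolzlKleineStephan2025, proof of Theorem 12] -/
theorem hksConst_pairwise (j : ℕ) {r : ℤ} (hrM : IsCoprime r (2 * (j : ℤ) + 8))
    (c : Fin (2 * j + 2) → ℤ)
    (hc : c = Matrix.vecCons (-(2 * (j : ℤ) + 8 + r)) (Matrix.vecCons r fun _ : Fin (2 * j) => 1)) :
    Pairwise fun i k => IsCoprime (c i) (c k) := by
  subst hc
  refine pairwise_isCoprime_cons ?_ (pairwise_isCoprime_cons (fun _ => isCoprime_one_right) ?_)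
  · intro i
    rcases Fin.eq_zero_or_eq_succ i with rfl | ⟨k, rfl⟩
    · obtain ⟨a, b, hab⟩ := hrM
      simp only [Matrix.cons_val_zero]
      exact ⟨-b, a - b, by linear_combination hab⟩
    · simp only [Matrix.cons_val_succ]
      exact isCoprime_one_right
  · intro i k _
    exact isCoprime_one_right

/-- `∑ min(cᵢ, 0) = −(2j+8+r)`: the block has exactly one negative entry (for `r ≥ 0`). [folklore] -/
theorem hksConst_sum_min (j : ℕ) {r : ℤ} (hr : 0 ≤ r) (c : Fin (2 * j + 2) → ℤ)
    (hc : c = Matrix.vecCons (-(2 * (j : ℤ) + 8 + r)) (Matrix.vecCons r fun _ : Fin (2 * j) => 1)) :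
    ∑ i, min (c i) 0 = -(2 * (j : ℤ) + 8 + r) := by
  subst hc
  rw [Fin.sum_univ_succ, Fin.sum_univ_succ]
  simp only [Matrix.cons_val_zero, Matrix.cons_val_succ]
  have h0 : min (-(2 * (j : ℤ) + 8 + r)) 0 = -(2 * (j : ℤ) + 8 + r) := min_eq_left (by linarith)
  have h1 : min r 0 = 0 := min_eq_right hr
  have h2 : min (1 : ℤ) 0 = 0 := min_eq_right zero_le_one
  rw [h0, h1, h2]
  simp

/-- No nonempty family of constants sums to zero: with the negative entry the sum is `≤ −8`,
without it the sum is positive. [cite: HolzlKleineStephan2025, proof of Theorem 12] -/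
theorem hksConst_subsum_ne_zero (j : ℕ) {r : ℤ} (hr : 0 < r) (c : Fin (2 * j + 2) → ℤ)
    (hc : c = Matrix.vecCons (-(2 * (j : ℤ) + 8 + r)) (Matrix.vecCons r fun _ : Fin (2 * j) => 1))
    (S : Finset (Fin (2 * j + 2))) (hS : S.Nonempty) : ∑ i ∈ S, c i ≠ 0 := by
  have key : ∑ i ∈ S, c i = ∑ i, if i ∈ S then c i else 0 := by
    rw [Finset.sum_ite_mem, Finset.univ_inter]
  subst hc
  by_cases h0 : (0 : Fin (2 * j + 2)) ∈ S
  · rw [key, Fin.sum_univ_succ, Fin.sum_univ_succ]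
    simp only [Matrix.cons_val_zero, Matrix.cons_val_succ, if_pos h0]
    have t1 : (if Fin.succ (0 : Fin (2 * j + 1)) ∈ S then r else 0) ≤ r := by
      split <;> linarith
    have t2 : ∑ i : Fin (2 * j), (if i.succ.succ ∈ S then (1 : ℤ) else 0) ≤ 2 * (j : ℤ) := by
      calc ∑ i : Fin (2 * j), (if i.succ.succ ∈ S then (1 : ℤ) else 0)
          ≤ ∑ _i : Fin (2 * j), (1 : ℤ) := Finset.sum_le_sum fun i _ => by split <;> norm_num
        _ = 2 * (j : ℤ) := by simp
    intro h
    linarith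
  · refine (Finset.sum_pos (fun i hi => ?_) hS).ne'
    have hi0 : i ≠ 0 := fun h => h0 (h ▸ hi)
    obtain ⟨k, rfl⟩ := Fin.exists_succ_eq.mpr hi0
    rcases Fin.eq_zero_or_eq_succ k with rfl | ⟨l, rfl⟩
    · simpa using hr
    · simp

/-! ### The Hölzl–Kleine–Stephan tuple

The `n = 2j + 5`-tuple is `a = (−(x+1)⁵, (x−1)⁵, 10(x²+1)², c)` (the paper's `a₃, a₁, a₂` first,
then the constants block `c`), again an explicit `Matrix.vecCons` term passed as `(a, ha : a = …)`. -/

/-- Entry `0` is `−(x+1)⁵`. [folklore] -/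
theorem hksTuple_zero {j : ℕ} (X : ℤ) (c : Fin (2 * j + 2) → ℤ) (a : Fin (2 * j + 2 + 3) → ℤ)
    (ha : a = Matrix.vecCons (-(X + 1) ^ 5) (Matrix.vecCons ((X - 1) ^ 5)
      (Matrix.vecCons (10 * (X ^ 2 + 1) ^ 2) c))) :
    a 0 = -(X + 1) ^ 5 := by
  subst ha
  rfl

/-- "`(x−1)⁵ + 10(x²+1)² − (x+1)⁵ = 8` holds independently of the choice of `x`; thus
`8 + a₄ + … + aₙ = 0`": the tuple sums to zero. [cite: HolzlKleineStephan2025, proof of Theorem 12] -/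
theorem hksTuple_sum (j : ℕ) (r X : ℤ) (c : Fin (2 * j + 2) → ℤ)
    (hc : c = Matrix.vecCons (-(2 * (j : ℤ) + 8 + r)) (Matrix.vecCons r fun _ : Fin (2 * j) => 1))
    (a : Fin (2 * j + 2 + 3) → ℤ)
    (ha : a = Matrix.vecCons (-(X + 1) ^ 5) (Matrix.vecCons ((X - 1) ^ 5)
      (Matrix.vecCons (10 * (X ^ 2 + 1) ^ 2) c))) :
    ∑ i, a i = 0 := by
  subst ha
  rw [Fin.sum_univ_succ, Fin.sum_univ_succ, Fin.sum_univ_succ]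
  simp only [Matrix.cons_val_zero, Matrix.cons_val_succ]
  rw [hksConst_sum j r c hc]
  ring

/-- The product of the entries. [folklore] -/
theorem hksTuple_prod (j : ℕ) (r X : ℤ) (c : Fin (2 * j + 2) → ℤ)
    (hc : c = Matrix.vecCons (-(2 * (j : ℤ) + 8 + r)) (Matrix.vecCons r fun _ : Fin (2 * j) => 1))
    (a : Fin (2 * j + 2 + 3) → ℤ)
    (ha : a = Matrix.vecCons (-(X + 1) ^ 5) (Matrix.vecCons ((X - 1) ^ 5)
      (Matrix.vecCons (10 * (X ^ 2 + 1) ^ 2) c))) :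
    ∏ i, a i = (X + 1) ^ 5 * (X - 1) ^ 5 * (10 * (X ^ 2 + 1) ^ 2) * ((2 * (j : ℤ) + 8 + r) * r) := by
  subst hc ha
  rw [Fin.prod_univ_succ, Fin.prod_univ_succ, Fin.prod_univ_succ]
  simp only [Matrix.cons_val_zero, Matrix.cons_val_succ]
  rw [Fin.prod_univ_succ, Fin.prod_univ_succ]
  simp only [Matrix.cons_val_zero, Matrix.cons_val_succ, Finset.prod_const_one]
  ring

/-- The subsums of the tuple, peeled: for any index set `S`,
`∑_{i ∈ S} aᵢ = [0 ∈ S](−(x+1)⁵) + [1 ∈ S](x−1)⁵ + [2 ∈ S]·10(x²+1)² + ∑ₖ [k+3 ∈ S] cₖ`. [folklore] -/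
theorem hksTuple_subsum {j : ℕ} (X : ℤ) (c : Fin (2 * j + 2) → ℤ) (a : Fin (2 * j + 2 + 3) → ℤ)
    (ha : a = Matrix.vecCons (-(X + 1) ^ 5) (Matrix.vecCons ((X - 1) ^ 5)
      (Matrix.vecCons (10 * (X ^ 2 + 1) ^ 2) c))) (S : Finset (Fin (2 * j + 2 + 3))) :
    ∑ i ∈ S, a i =
      (if (0 : Fin (2 * j + 2 + 3)) ∈ S then -(X + 1) ^ 5 else 0) +
        ((if Fin.succ (0 : Fin (2 * j + 2 + 2)) ∈ S then (X - 1) ^ 5 else 0) +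
          ((if Fin.succ (Fin.succ (0 : Fin (2 * j + 2 + 1))) ∈ S then 10 * (X ^ 2 + 1) ^ 2 else 0) +
            ∑ i : Fin (2 * j + 2), if i.succ.succ.succ ∈ S then c i else 0)) := by
  have key : ∑ i ∈ S, a i = ∑ i, if i ∈ S then a i else 0 := by
    rw [Finset.sum_ite_mem, Finset.univ_inter]
  rw [key]
  subst ha
  rw [Fin.sum_univ_succ, Fin.sum_univ_succ, Fin.sum_univ_succ]
  simp only [Matrix.cons_val_zero, Matrix.cons_val_succ]

/-- Admissibility of the tuple for `x > 2j + 9 + r`, `r > 0`: zero sum, no common non-unit divisor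
(the constants `−(2j+8+r)` and `r` are coprime), and no vanishing nonempty proper subsum.
[cite: HolzlKleineStephan2025, proof of Theorem 12] -/
theorem isAdmissibleSum_hksTuple (j : ℕ) {r X : ℤ} (hr : 0 < r)
    (hrM : IsCoprime r (2 * (j : ℤ) + 8)) (hX : 2 * (j : ℤ) + 9 + r < X) (c : Fin (2 * j + 2) → ℤ)
    (hc : c = Matrix.vecCons (-(2 * (j : ℤ) + 8 + r)) (Matrix.vecCons r fun _ : Fin (2 * j) => 1))
    (a : Fin (2 * j + 2 + 3) → ℤ)
    (ha : a = Matrix.vecCons (-(X + 1) ^ 5) (Matrix.vecCons ((X - 1) ^ 5)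
      (Matrix.vecCons (10 * (X ^ 2 + 1) ^ 2) c))) :
    IsAdmissibleSum a := by
  refine ⟨hksTuple_sum j r X c hc a ha, ?_, ?_⟩
  · intro d hd
    subst hc ha
    have h3 : d ∣ -(2 * (j : ℤ) + 8 + r) := hd (Fin.succ (Fin.succ (Fin.succ 0)))
    have h4 : d ∣ r := hd (Fin.succ (Fin.succ (Fin.succ (Fin.succ 0))))
    obtain ⟨u, v, huv⟩ := hrM
    have hcop : IsCoprime (-(2 * (j : ℤ) + 8 + r)) r := ⟨-v, u - v, by linear_combination huv⟩
    exact hcop.isUnit_of_dvd' h3 h4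
  · -- no vanishing nonempty proper subsum
    have hsum0 := hksTuple_sum j r X c hc a ha
    -- first: the claim for index sets avoiding `0`
    have main : ∀ S : Finset (Fin (2 * j + 2 + 3)), S.Nonempty → (0 : Fin (2 * j + 2 + 3)) ∉ S →
        ∑ i ∈ S, a i ≠ 0 := by
      intro S hS h0 hsum
      rw [hksTuple_subsum X c a ha, if_neg h0, zero_add] at hsum
      have hX1 : 2 * (j : ℤ) + 8 + r < (X - 1) ^ 5 := by
        have : X - 1 ≤ (X - 1) ^ 5 := le_self_pow₀ (by linarith) (by norm_num)
        linarith
      have hX2 : 2 * (j : ℤ) + 8 + r < 10 * (X ^ 2 + 1) ^ 2 := by nlinarith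
      have htail : -(2 * (j : ℤ) + 8 + r) ≤
          ∑ i : Fin (2 * j + 2), (if i.succ.succ.succ ∈ S then c i else 0) := by
        calc -(2 * (j : ℤ) + 8 + r) = ∑ i : Fin (2 * j + 2), min (c i) 0 :=
              (hksConst_sum_min j hr.le c hc).symm
          _ ≤ _ := Finset.sum_le_sum fun i _ => by
              split
              · exact min_le_left _ _
              · exact min_le_right _ _
      by_cases h1 : Fin.succ (0 : Fin (2 * j + 2 + 2)) ∈ S
      · rw [if_pos h1] at hsum
        have t2 : (0 : ℤ) ≤
            (if Fin.succ (Fin.succ (0 : Fin (2 * j + 2 + 1))) ∈ S then 10 * (X ^ 2 + 1) ^ 2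
              else 0) := by
          split <;> positivity
        linarith
      rw [if_neg h1, zero_add] at hsum
      by_cases h2 : Fin.succ (Fin.succ (0 : Fin (2 * j + 2 + 1))) ∈ S
      · rw [if_pos h2] at hsum
        linarith
      rw [if_neg h2, zero_add, ← Finset.sum_filter] at hsum
      refine hksConst_subsum_ne_zero j hr c hc _ ?_ hsum
      obtain ⟨k, hk⟩ := hS
      rcases Fin.eq_zero_or_eq_succ k with rfl | ⟨k, rfl⟩
      · exact absurd hk h0
      rcases Fin.eq_zero_or_eq_succ k with rfl | ⟨k, rfl⟩
      · exact absurd hk h1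
      rcases Fin.eq_zero_or_eq_succ k with rfl | ⟨k, rfl⟩
      · exact absurd hk h2
      exact ⟨k, Finset.mem_filter.2 ⟨Finset.mem_univ _, hk⟩⟩
    intro S hS hS' hsum
    by_cases h0 : (0 : Fin (2 * j + 2 + 3)) ∈ S
    · -- pass to the complement
      refine main Sᶜ ?_ ?_ ?_
      · rw [Finset.nonempty_iff_ne_empty, Ne, Finset.compl_eq_empty_iff]
        exact hS'
      · rw [Finset.mem_compl, not_not]
        exact h0
      · have h := Finset.sum_add_sum_compl S a
        rw [hsum0, hsum, zero_add] at h
        exact h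
    · exact main S hS h0 hsum

/-- Pairwise coprimality of the tuple when `10 r (2j+8+r) ∣ x` ("`x` is even", "`10` divides `x`",
"`x` is a multiple … of each of `a₄, …, aₙ`") and `gcd(10, r) = gcd(10, 2j+8+r) = gcd(r, 2j+8) = 1`.
[cite: HolzlKleineStephan2025, proof of Theorem 12] -/
theorem hksTuple_pairwise (j : ℕ) {r X : ℤ} (h10r : IsCoprime 10 r)
    (h10N : IsCoprime 10 (2 * (j : ℤ) + 8 + r)) (hrM : IsCoprime r (2 * (j : ℤ) + 8))
    (hX : 10 * (r * (2 * (j : ℤ) + 8 + r)) ∣ X) (c : Fin (2 * j + 2) → ℤ)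
    (hc : c = Matrix.vecCons (-(2 * (j : ℤ) + 8 + r)) (Matrix.vecCons r fun _ : Fin (2 * j) => 1))
    (a : Fin (2 * j + 2 + 3) → ℤ)
    (ha : a = Matrix.vecCons (-(X + 1) ^ 5) (Matrix.vecCons ((X - 1) ^ 5)
      (Matrix.vecCons (10 * (X ^ 2 + 1) ^ 2) c))) :
    Pairwise fun i k => IsCoprime (a i) (a k) := by
  have h10X : (10 : ℤ) ∣ X := (dvd_mul_right _ _).trans hX
  have h2X : (2 : ℤ) ∣ X := (show (2 : ℤ) ∣ 10 by norm_num).trans h10X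
  have hcX : ∀ i, c i ∣ X := fun i =>
    ((hksConst_dvd j r c hc i).trans (dvd_mul_left _ _)).trans hX
  obtain ⟨hpm, hpq, hmq⟩ := isCoprime_of_even_param h2X
  obtain ⟨hp10, hm10, -⟩ := isCoprime_of_dvd_param h10X
  subst ha
  refine pairwise_isCoprime_cons ?_ (pairwise_isCoprime_cons ?_ (pairwise_isCoprime_cons ?_
    (hksConst_pairwise j hrM c hc)))
  · intro i
    rcases Fin.eq_zero_or_eq_succ i with rfl | ⟨i, rfl⟩
    · simp only [Matrix.cons_val_zero]
      exact hpm.pow.neg_left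
    rcases Fin.eq_zero_or_eq_succ i with rfl | ⟨k, rfl⟩
    · simp only [Matrix.cons_val_succ, Matrix.cons_val_zero]
      exact (hp10.mul_right hpq.pow_right).pow_left.neg_left
    · simp only [Matrix.cons_val_succ]
      exact (isCoprime_of_dvd_param (hcX k)).1.pow_left.neg_left
  · intro i
    rcases Fin.eq_zero_or_eq_succ i with rfl | ⟨k, rfl⟩
    · simp only [Matrix.cons_val_zero]
      exact (hm10.mul_right hmq.pow_right).pow_left
    · simp only [Matrix.cons_val_succ]
      exact (isCoprime_of_dvd_param (hcX k)).2.1.pow_left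
  · intro k
    exact (hksConst_coprime_ten j h10r h10N c hc k).mul_left
      (isCoprime_of_dvd_param (hcX k)).2.2.pow_left

/-- The radical bound: if `x² + 1 = (y²+1)t²`, then `∏ aᵢ` divides a power of
`B = (x+1)(x−1)·(10(y²+1)t)·((2j+8+r)r)`, hence `rad(∏ aᵢ) ∣ B` ("`a₂ = 10(x²+1)² = 10(y²+1)²t⁴`
only contributes a factor `t ∈ O(x)` to the radical. Thus we have `rad(a₁ ⋯ aₙ) ∈ O(x³)`").
[cite: HolzlKleineStephan2025, proof of Theorem 12] -/
theorem radical_hksTuple_dvd (j : ℕ) {r X y t : ℤ} (hr : 0 < r) (hX : 2 ≤ X)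
    (hpell : X ^ 2 + 1 = (y ^ 2 + 1) * t ^ 2) (c : Fin (2 * j + 2) → ℤ)
    (hc : c = Matrix.vecCons (-(2 * (j : ℤ) + 8 + r)) (Matrix.vecCons r fun _ : Fin (2 * j) => 1))
    (a : Fin (2 * j + 2 + 3) → ℤ)
    (ha : a = Matrix.vecCons (-(X + 1) ^ 5) (Matrix.vecCons ((X - 1) ^ 5)
      (Matrix.vecCons (10 * (X ^ 2 + 1) ^ 2) c))) :
    radical (∏ i, a i) ∣
      (X + 1) * (X - 1) * (10 * (y ^ 2 + 1) * t) * ((2 * (j : ℤ) + 8 + r) * r) := by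
  set B : ℤ := (X + 1) * (X - 1) * (10 * (y ^ 2 + 1) * t) * ((2 * (j : ℤ) + 8 + r) * r) with hB
  have hne : ∏ i, a i ≠ 0 := by
    rw [hksTuple_prod j r X c hc a ha]
    have h1 : (0 : ℤ) < X - 1 := by linarith
    have h2 : (0 : ℤ) < 2 * (j : ℤ) + 8 + r := by positivity
    positivity
  refine (exists_dvd_pow_iff_radical_dvd hne).mp ⟨15, ?_⟩
  rw [hksTuple_prod j r X c hc a ha]
  have d1 : (X + 1) ^ 5 ∣ B ^ 5 := pow_dvd_pow_of_dvd ⟨(X - 1) * (10 * (y ^ 2 + 1) * t) *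
    ((2 * (j : ℤ) + 8 + r) * r), by rw [hB]; ring⟩ 5
  have d2 : (X - 1) ^ 5 ∣ B ^ 5 := pow_dvd_pow_of_dvd ⟨(X + 1) * (10 * (y ^ 2 + 1) * t) *
    ((2 * (j : ℤ) + 8 + r) * r), by rw [hB]; ring⟩ 5
  have d3 : 10 * (X ^ 2 + 1) ^ 2 ∣ B ^ 4 := by
    have h3 : 10 * (X ^ 2 + 1) ^ 2 ∣ (10 * (y ^ 2 + 1) * t) ^ 4 :=
      ⟨10 ^ 3 * (y ^ 2 + 1) ^ 2, by rw [hpell]; ring⟩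
    exact h3.trans (pow_dvd_pow_of_dvd ⟨(X + 1) * (X - 1) * ((2 * (j : ℤ) + 8 + r) * r),
      by rw [hB]; ring⟩ 4)
  have d4 : (2 * (j : ℤ) + 8 + r) * r ∣ B ^ 1 :=
    ⟨(X + 1) * (X - 1) * (10 * (y ^ 2 + 1) * t), by rw [hB]; ring⟩
  have h := mul_dvd_mul (mul_dvd_mul (mul_dvd_mul d1 d2) d3) d4
  rwa [← pow_add, ← pow_add, ← pow_add] at h

/-- Hence `rad(∏ aᵢ) ≤ K x³` with `K = 10(y²+1)(2j+8+r)r` depending on `j, r` only (using `t ≤ x`).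
[cite: HolzlKleineStephan2025, proof of Theorem 12] -/
theorem radical_hksTuple_le (j : ℕ) {r X y t : ℤ} (hr : 0 < r) (hy : 1 ≤ y) (hX : 2 ≤ X)
    (ht : 0 < t) (hpell : X ^ 2 + 1 = (y ^ 2 + 1) * t ^ 2) (c : Fin (2 * j + 2) → ℤ)
    (hc : c = Matrix.vecCons (-(2 * (j : ℤ) + 8 + r)) (Matrix.vecCons r fun _ : Fin (2 * j) => 1))
    (a : Fin (2 * j + 2 + 3) → ℤ)
    (ha : a = Matrix.vecCons (-(X + 1) ^ 5) (Matrix.vecCons ((X - 1) ^ 5)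
      (Matrix.vecCons (10 * (X ^ 2 + 1) ^ 2) c))) :
    (radical (∏ i, a i) : ℤ) ≤ 10 * (y ^ 2 + 1) * ((2 * (j : ℤ) + 8 + r) * r) * X ^ 3 := by
  set K : ℤ := 10 * (y ^ 2 + 1) * ((2 * (j : ℤ) + 8 + r) * r) with hK
  have hK0 : 0 < K := by
    have h2 : (0 : ℤ) < 2 * (j : ℤ) + 8 + r := by positivity
    positivity
  have htX : t ≤ X := pell_t_le_x hy (by linarith) hpell
  have hBpos : 0 < (X + 1) * (X - 1) * (10 * (y ^ 2 + 1) * t) * ((2 * (j : ℤ) + 8 + r) * r) := by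
    have h1 : (0 : ℤ) < X - 1 := by linarith
    have h2 : (0 : ℤ) < 2 * (j : ℤ) + 8 + r := by positivity
    positivity
  have h := Int.le_of_dvd hBpos (radical_hksTuple_dvd j hr hX hpell c hc a ha)
  calc (radical (∏ i, a i) : ℤ)
      ≤ (X + 1) * (X - 1) * (10 * (y ^ 2 + 1) * t) * ((2 * (j : ℤ) + 8 + r) * r) := h
    _ = K * ((X ^ 2 - 1) * t) := by rw [hK]; ring
    _ ≤ K * (X ^ 2 * X) := by
        apply mul_le_mul_of_nonneg_left _ hK0.le
        exact mul_le_mul (by linarith) htX ht.le (by positivity)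
    _ = K * X ^ 3 := by ring

/-- The radical exceeds `1` (the product is at least `2`). [folklore] -/
theorem one_lt_radical_hksTuple (j : ℕ) {r X : ℤ} (hr : 0 < r) (hX : 2 ≤ X)
    (c : Fin (2 * j + 2) → ℤ)
    (hc : c = Matrix.vecCons (-(2 * (j : ℤ) + 8 + r)) (Matrix.vecCons r fun _ : Fin (2 * j) => 1))
    (a : Fin (2 * j + 2 + 3) → ℤ)
    (ha : a = Matrix.vecCons (-(X + 1) ^ 5) (Matrix.vecCons ((X - 1) ^ 5)
      (Matrix.vecCons (10 * (X ^ 2 + 1) ^ 2) c))) :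
    (1 : ℝ) < ((radical (∏ i, a i) : ℤ) : ℝ) := by
  have hP : 2 ≤ ∏ i, a i := by
    rw [hksTuple_prod j r X c hc a ha]
    have hA : (2 : ℤ) ≤ (X + 1) ^ 5 := by
      calc (2 : ℤ) ≤ X + 1 := by linarith
        _ ≤ (X + 1) ^ 5 := le_self_pow₀ (by linarith) (by norm_num)
    have hB : (1 : ℤ) ≤ (X - 1) ^ 5 := one_le_pow₀ (by linarith)
    have hC : (1 : ℤ) ≤ 10 * (X ^ 2 + 1) ^ 2 := by nlinarith
    have hD : (1 : ℤ) ≤ (2 * (j : ℤ) + 8 + r) * r := by nlinarith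
    calc (2 : ℤ) ≤ (X + 1) ^ 5 := hA
      _ ≤ (X + 1) ^ 5 * (X - 1) ^ 5 := le_mul_of_one_le_right (by linarith) hB
      _ ≤ (X + 1) ^ 5 * (X - 1) ^ 5 * (10 * (X ^ 2 + 1) ^ 2) :=
          le_mul_of_one_le_right (by positivity) hC
      _ ≤ _ := le_mul_of_one_le_right (by positivity) hD
  have hlt : 1 < radical (∏ i, a i) := by
    rw [Int.one_lt_radical_iff]
    have h0 : (((∏ i, a i).natAbs : ℕ) : ℤ) = ∏ i, a i := Int.natAbs_of_nonneg (by linarith)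
    omega
  exact_mod_cast hlt

/-- The size is at least `(x+1)⁵ ≥ x⁵` ("`max{|a₁|, …, |aₙ|} = |a₃| = |x+1|⁵`").
[cite: HolzlKleineStephan2025, proof of Theorem 12] -/
theorem tupleMax_hksTuple_ge {j : ℕ} {X : ℤ} (hX : 0 ≤ X) (c : Fin (2 * j + 2) → ℤ)
    (a : Fin (2 * j + 2 + 3) → ℤ)
    (ha : a = Matrix.vecCons (-(X + 1) ^ 5) (Matrix.vecCons ((X - 1) ^ 5)
      (Matrix.vecCons (10 * (X ^ 2 + 1) ^ 2) c))) :
    ((X : ℝ) + 1) ^ 5 ≤ (tupleMax a : ℝ) := by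
  have h : (a 0).natAbs ≤ tupleMax a :=
    Finset.le_sup (f := fun i => (a i).natAbs) (Finset.mem_univ 0)
  rw [hksTuple_zero X c a ha, Int.natAbs_neg] at h
  have h1 : ((((X + 1) ^ 5).natAbs : ℕ) : ℤ) ≤ ((tupleMax a : ℕ) : ℤ) := by exact_mod_cast h
  rw [Int.natAbs_of_nonneg (by positivity)] at h1
  have h2 : (((X + 1) ^ 5 : ℤ) : ℝ) ≤ (((tupleMax a : ℕ) : ℤ) : ℝ) := by exact_mod_cast h1
  push_cast at h2
  exact h2

/-! ### Hölzl–Kleine–Stephan's theorem -/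

/-- **Hölzl–Kleine–Stephan, Theorem 12, `n = 2j + 5` terms, parametric form:** for `r > 0` with
`gcd(10, r) = gcd(10, 2j+8+r) = gcd(r, 2j+8) = 1` and every `θ < 5/3`, infinitely many admissible
pairwise coprime `(2j+5)`-term sums have quality `> θ` — the tuples
`(−(x+1)⁵, (x−1)⁵, 10(x²+1)², −(2j+8+r), r, 1, …, 1)` along the Pell solutions `x` for
`y = 10 r (2j+8+r)`. [cite: HolzlKleineStephan2025, Theorem 12] -/
theorem hks_infinite (j : ℕ) {r : ℤ} (hr : 0 < r) (h10r : IsCoprime 10 r)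
    (h10N : IsCoprime 10 (2 * (j : ℤ) + 8 + r)) (hrM : IsCoprime r (2 * (j : ℤ) + 8)) {θ : ℝ}
    (hθ : θ < 5 / 3) :
    {a : Fin (2 * j + 2 + 3) → ℤ | IsAdmissibleSum a ∧ Pairwise (fun i k => IsCoprime (a i) (a k)) ∧
      θ < nQuality a}.Infinite := by
  set c : Fin (2 * j + 2) → ℤ :=
    Matrix.vecCons (-(2 * (j : ℤ) + 8 + r)) (Matrix.vecCons r fun _ : Fin (2 * j) => 1) with hc
  set N : ℤ := 2 * (j : ℤ) + 8 + r with hN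
  have hN0 : 0 < N := by positivity
  set y : ℤ := 10 * (r * N) with hy
  have hy0 : 0 < y := by positivity
  have hy1 : 1 ≤ y := hy0
  set Kz : ℤ := 10 * (y ^ 2 + 1) * (N * r) with hKz
  have hKz : 0 < Kz := by positivity
  have hK : (1 : ℝ) ≤ (Kz : ℝ) := by exact_mod_cast hKz
  obtain ⟨X₀, hX₀⟩ := nQuality_gt_of_pow_bounds (n := 2 * j + 2 + 3) (p := 5) (q := 3) (θ := θ) hK
    (by push_cast; linarith)
  refine Set.Infinite.of_image tupleMax (Set.infinite_of_not_bddAbove ?_)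
  rintro ⟨Bd, hBd⟩
  obtain ⟨e, he⟩ := exists_nat_ge (max X₀ ((Bd : ℝ) + 1) - y)
  obtain ⟨X, t, hpell, hyX, hXge, ht⟩ := exists_pell_solution hy0 e
  have hXy : y ≤ X := by
    have : (0 : ℤ) ≤ e := by positivity
    linarith
  have hX2 : 2 ≤ X := by
    have : (2 : ℤ) ≤ y := by rw [hy]; nlinarith
    linarith
  have hXbig : 2 * (j : ℤ) + 9 + r < X := by
    have : N + 1 < y := by rw [hy]; nlinarith
    linarith
  have hXreal : X₀ ≤ (X : ℝ) ∧ (Bd : ℝ) + 1 ≤ (X : ℝ) := by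
    have h1 : ((y + e : ℤ) : ℝ) ≤ (X : ℝ) := by exact_mod_cast hXge
    push_cast at h1
    constructor
    · linarith [le_max_left X₀ ((Bd : ℝ) + 1)]
    · linarith [le_max_right X₀ ((Bd : ℝ) + 1)]
  set a : Fin (2 * j + 2 + 3) → ℤ := Matrix.vecCons (-(X + 1) ^ 5) (Matrix.vecCons ((X - 1) ^ 5)
    (Matrix.vecCons (10 * (X ^ 2 + 1) ^ 2) c)) with ha
  have hadm : IsAdmissibleSum a := isAdmissibleSum_hksTuple j hr hrM hXbig c hc a ha
  have hpw : Pairwise fun i k => IsCoprime (a i) (a k) :=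
    hksTuple_pairwise j h10r h10N hrM hyX c hc a ha
  have hM : (X : ℝ) ^ 5 ≤ (tupleMax a : ℝ) := by
    have h1 := tupleMax_hksTuple_ge (X := X) (by linarith) c a ha
    have h2 : (X : ℝ) ^ 5 ≤ ((X : ℝ) + 1) ^ 5 := by
      have : (0 : ℝ) ≤ (X : ℝ) := by exact_mod_cast (show (0 : ℤ) ≤ X by linarith)
      gcongr
      linarith
    linarith
  have hR1 := one_lt_radical_hksTuple j hr hX2 c hc a ha
  have hRle : ((radical (∏ i, a i) : ℤ) : ℝ) ≤ (Kz : ℝ) * (X : ℝ) ^ 3 := by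
    have h := radical_hksTuple_le j hr hy1 hX2 ht hpell c hc a ha
    have h' : ((radical (∏ i, a i) : ℤ) : ℝ) ≤ ((Kz * X ^ 3 : ℤ) : ℝ) := by exact_mod_cast h
    push_cast at h'
    exact h'
  have hq : θ < nQuality a := hX₀ _ (X : ℝ) hXreal.1 hM hR1 hRle
  have hmem : tupleMax a ∈ tupleMax '' {a : Fin (2 * j + 2 + 3) → ℤ |
      IsAdmissibleSum a ∧ Pairwise (fun i k => IsCoprime (a i) (a k)) ∧ θ < nQuality a} :=
    ⟨a, ⟨hadm, hpw, hq⟩, rfl⟩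
  have hle := hBd hmem
  have hle' : (tupleMax a : ℝ) ≤ (Bd : ℝ) := by exact_mod_cast hle
  have hX1 : (X : ℝ) ≤ (X : ℝ) ^ 5 := by
    have : (1 : ℝ) ≤ (X : ℝ) := by exact_mod_cast (show (1 : ℤ) ≤ X by linarith)
    exact le_self_pow₀ this (by norm_num)
  linarith [hXreal.2]

/-- **Hölzl–Kleine–Stephan (2025), Theorem 12 — discharge of the named fact
`PairwiseQualityFloorOdd`:** for every odd `n ≥ 5` and every `θ < 5/3` there are infinitely many
pairwise coprime admissible `n`-term sums of quality `> θ` (printed: `Q_{U(F,n)} ≥ 5/3` for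
`2, 5, 10 ∉ F`, odd `n ≥ 5`, whence `Q_{R(n)} ≥ 5/3` by Fact 11). With `n = 2j + 5` we take
`r = 1`, or `r = 4j + 17` when `5 ∣ 2j + 9`. [cite: HolzlKleineStephan2025, Theorem 12 with Fact 11] -/
theorem PairwiseQualityFloorOdd_holds : PairwiseQualityFloorOdd := by
  intro n hn hodd θ hθ
  obtain ⟨m, hm⟩ := hodd
  obtain ⟨j, rfl⟩ : ∃ j, n = 2 * j + 2 + 3 := ⟨(n - 5) / 2, by omega⟩
  by_cases h5 : j % 5 = 3
  · have h10r : IsCoprime (10 : ℤ) ((4 * j + 17 : ℕ) : ℤ) :=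
      isCoprime_ten_of_not_dvd (by omega) (by omega)
    have h10N : IsCoprime (10 : ℤ) ((6 * j + 25 : ℕ) : ℤ) :=
      isCoprime_ten_of_not_dvd (by omega) (by omega)
    refine hks_infinite j (r := 4 * (j : ℤ) + 17) (by positivity) (by exact_mod_cast h10r) ?_
      ⟨1, -2, by ring⟩ hθ
    convert h10N using 2
    push_cast
    ring
  · have h10N : IsCoprime (10 : ℤ) ((2 * j + 9 : ℕ) : ℤ) :=
      isCoprime_ten_of_not_dvd (by omega) (by omega)
    refine hks_infinite j (r := 1) one_pos isCoprime_one_right ?_ isCoprime_one_left hθ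
    convert h10N using 2
    push_cast
    ring

end Literature.Barriers.ABC

end
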